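import Summits.BirchSwinnertonDyer.BirchSwinnertonDyer.Theorems.PrintCFramBottomClassIndexLawFiveLeBorelOrderTelescopeBridge
import HarnessLib

/-!
# Route `PrintCFram`, crux C2 `BottomClassIndexLawFiveLe` (stmt-BirchSwinnertonDyer-20372), line
# `eisenstein-resource-bdp-line` (registry v32), road II UPPER (Kolyvagin at the Borel CM-ramified prime):
# **KOLYVAGIN'S ORDER TELESCOPE, III — A STEP-DEPENDENT DEFECT BUDGET `Σ Nⱼ ≤ M₀ + Σ D j`**
# (sequel of `…BorelOrderTelescope` / `…BorelOrderTelescopeBridge`, w2 g8; cell `bsd-print-cfram`, width seat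
# `bsd-line-cfram-p1-w8` g17; helper `--supports` 20372; 0 defs, 0 facts, 0 sorry)

HONEST FRAMING. Nothing about BSD is proved here and nothing of any stub; this is pure algebra. Files I/II run
McCallum's Cassels–Tate induction (Thm. 5.4, (16)–(23)) with a kernel-form Čebotarev axiom whose defect `Δ ν` is
keyed to the SIGN `ν` of a class and book the constant budget `Δ1 + Δ(−1)` per step (`Σ Nᵢ ≤ M₀ + K·(Δ1+Δ(−1))`;
Borel rule `Δ η = 0`, `Δ (−η) = 1`). That is the right ledger when every Kolyvagin prime is of Gross's type (3.2)
(`Frob ℓ = Frob ∞` on `K″(W[p^M])`), which under-sees the odd-depth classes of sign `−η_line`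
(w2 g6 `…BorelKolyvaginBlind`). Width seat w5 g12 (`…BorelTypeTwoCebotarev`, `…BorelTypeTwoCongruences`, crux
notes `Lines/eisenstein-resource-bdp-line-w5g12-type2.md`) observed that on a PROPER quadratic twist of the class
the numerical Kolyvagin primes come in TWO Frobenius types, `[c₀]` and `[c₀ z]` (`z` acting on `W[p^M]` as `−1`),
and that a type-two prime swaps the local eigenlines (it under-sees the odd-depth classes of sign `η_line`
instead). So at each step of the chain the prover may CHOOSE on which of the step's two classes (the lift
`s_{k+1}` of sign `ν`, the Kolyvagin class `c(n_k)` of sign `−ν`) the possible defect falls, and the per-step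
budget is no longer a constant. This file re-runs the induction with a displayed budget `D : ℕ → ℕ` indexed by the
step and a supplier that receives the step index and returns its own split `d₁ + d₂ ≤ D j`; the sequel
`…BorelOrderTelescopeTwoTypes` shows files I/II are the constant case and derives from a PAIR of suppliers (type
one / type two) the budget `D j = δ(s_j)` and the depth-currency ledger `Σ ⌈dp sⱼ/2⌉ ≤ M₀ + #{j : dp sⱼ odd}`.

WHAT IS PROVED (hypotheses explicit, names/shapes as in `…BorelOrderTelescope`; `expo` an exact-exponent
function, `p^a v = 0 ↔ expo v ≤ a`):
* §1 `exists_chain_of_casselsTate_stepDefect` — the chain `n_k = ℓ₁⋯ℓ_k` with the invariant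
  **(I_D)** `p^i c(n_k) ∈ ⟨s_j : j > k⟩ ⟹ (M − M₀) + Σ_{j≤k} expo s_j ≤ i + Σ_{j≤k} D j`, from the supplier
  `hCebD` (at step `j`, for the lift `s_j` of sign `ν`, any class `g₂` of sign `−ν` and any finite set `T` of
  eigenclasses: a Kolyvagin prime above any bound killing `T`, with `p^i s_j ∈ A ℓ ⟹ p^{i+d₁} s_j ∈ ⟨T⟩`,
  `p^i g₂ ∈ A ℓ ⟹ p^{i+d₂} g₂ ∈ ⟨T⟩`, `d₁ + d₂ ≤ D j`).
* §2 `sum_expo_le_M₀_add_sum_of_casselsTate_stepDefect` — **`Σ_{j≤K} expo s_j ≤ M₀ + Σ_{j≤K} D j`** (the tree's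
  `HypothesesM.sum_expo_le_M₀_of_casselsTate` is `D ≡ 0`; file II is `D ≡ Δ1 + Δ(−1)`).
THEOREMS ONLY; no definition, no named fact, no `sorry`. UPPER is NOT claimed; BSD is not proved by any of this;
no summit statement is proved by this seat. References: [McCallumLMS1991] §1 Theorem, §3 Prop. 3.1/Cor. 3.2,
§4 Prop. 4.4, Prop. 4.7, §5 Lemma 5.3, Thm. 5.4 (proof, (16)–(23)), Cor. 5.6; [GrossLMS1991] §3 (3.1)–(3.3).
-/

set_option autoImplicit false
-- `…BirchSwinnertonDyer.BirchSwinnertonDyer.Theorems…` is the problem's mandated namespace (D-0017).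
set_option linter.dupNamespace false

noncomputable section

open scoped Classical

namespace Summit.BirchSwinnertonDyer.BirchSwinnertonDyer.Theorems.PrintCFram.BorelDescent

open Literature.NumberTheory.EllipticCurves Literature.NumberTheory.EllipticCurves.KolyvaginDescent
  Summit.BirchSwinnertonDyer.BirchSwinnertonDyer.Theorems.SylvesterTwoUpper.DescentDefect

/-! ## §0 Algebraic preliminaries (the private lemmas of file I, re-proved: they are private there) -/

section Prelim

variable {V : Type*} [AddCommGroup V]

/-- An element of the subgroup generated by `{s i : i ∈ I}` is a `ℤ`-combination of the `s i`.
[folklore] (re-proved from `…BorelOrderTelescope`, where it is private) -/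
private theorem exists_sum_of_mem_closure_image' (s : ℕ → V) (I : Finset ℕ) {v : V}
    (hv : v ∈ AddSubgroup.closure ((I.image s : Finset V) : Set V)) :
    ∃ a : ℕ → ℤ, v = ∑ i ∈ I, a i • s i := by
  induction hv using AddSubgroup.closure_induction with
  | mem w hw =>
    rw [Finset.coe_image, Set.mem_image] at hw
    obtain ⟨i, hi, rfl⟩ := hw
    rw [Finset.mem_coe] at hi
    refine ⟨fun j ↦ if j = i then 1 else 0, ?_⟩
    simp only [ite_smul, one_smul, zero_smul, Finset.sum_ite_eq', hi, if_true]
  | zero => exact ⟨0, by simp⟩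
  | add w w' _ _ hw hw' =>
    obtain ⟨a, rfl⟩ := hw
    obtain ⟨a', rfl⟩ := hw'
    exact ⟨a + a', by simp only [Pi.add_apply, add_smul, Finset.sum_add_distrib]⟩
  | neg w _ hw =>
    obtain ⟨a, rfl⟩ := hw
    exact ⟨-a, by simp only [Pi.neg_apply, neg_smul, Finset.sum_neg_distrib]⟩

/-- Independence of `x, s₁, …, s_K` as a flag condition: `a s_k ∈ ⟨s_j : k < j ≤ K⟩ ⟹ a s_k = 0`.
[folklore] (re-proved from `…BorelOrderTelescope`, where it is private) -/
private theorem zsmul_eq_zero_of_mem_closure_Ioc' {x : V} {K : ℕ} {s : ℕ → V}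
    (hind : ∀ (b : ℤ) (a : ℕ → ℤ), b • x + ∑ i ∈ Finset.Ioc 0 K, a i • s i = 0 →
      b • x = 0 ∧ ∀ i ∈ Finset.Ioc 0 K, a i • s i = 0)
    {k : ℕ} (hk : k ∈ Finset.Ioc 0 K) {a : ℤ}
    (h : a • s k ∈ AddSubgroup.closure (((Finset.Ioc k K).image s : Finset V) : Set V)) :
    a • s k = 0 := by
  obtain ⟨c, hc⟩ := exists_sum_of_mem_closure_image' s _ h
  have hkk : k ∉ Finset.Ioc k K := by simp
  have hsub : Finset.Ioc 0 K ∩ Finset.Ioc k K = Finset.Ioc k K := by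
    apply Finset.inter_eq_right.mpr
    intro i hi
    simp only [Finset.mem_Ioc] at hi hk ⊢
    omega
  set a' : ℕ → ℤ := fun i ↦ (if i = k then a else 0) + (if i ∈ Finset.Ioc k K then -c i else 0)
    with ha'
  have hsum : (0 : ℤ) • x + ∑ i ∈ Finset.Ioc 0 K, a' i • s i = 0 := by
    simp only [ha', add_smul, ite_smul, zero_smul, neg_smul, Finset.sum_add_distrib, Finset.sum_ite_eq',
      hk, if_true, Finset.sum_ite_mem, hsub, Finset.sum_neg_distrib, zero_add, ← hc, add_neg_cancel]
  have := (hind 0 a' hsum).2 k hk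
  simpa [ha', hkk] using this

/-- Independence of `x` from the lifts: `a x ∈ ⟨s_j : k < j ≤ K⟩ ⟹ a x = 0`.
[folklore] (re-proved from `…BorelOrderTelescope`, where it is private) -/
private theorem zsmul_x_eq_zero_of_mem_closure_Ioc' {x : V} {K : ℕ} {s : ℕ → V}
    (hind : ∀ (b : ℤ) (a : ℕ → ℤ), b • x + ∑ i ∈ Finset.Ioc 0 K, a i • s i = 0 →
      b • x = 0 ∧ ∀ i ∈ Finset.Ioc 0 K, a i • s i = 0)
    {k : ℕ} {a : ℤ}
    (h : a • x ∈ AddSubgroup.closure (((Finset.Ioc k K).image s : Finset V) : Set V)) :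
    a • x = 0 := by
  obtain ⟨c, hc⟩ := exists_sum_of_mem_closure_image' s _ h
  have hsub : Finset.Ioc 0 K ∩ Finset.Ioc k K = Finset.Ioc k K := by
    apply Finset.inter_eq_right.mpr
    intro i hi
    simp only [Finset.mem_Ioc] at hi ⊢
    omega
  set a' : ℕ → ℤ := fun i ↦ if i ∈ Finset.Ioc k K then -c i else 0 with ha'
  have hsum : a • x + ∑ i ∈ Finset.Ioc 0 K, a' i • s i = 0 := by
    simp only [ha', ite_smul, zero_smul, neg_smul, Finset.sum_ite_mem, hsub, Finset.sum_neg_distrib, hc,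
      add_neg_cancel]
  exact (hind a a' hsum).1

/-- Isotropy along a span: if `P s t = 0` for every `t ∈ S ⊆ Sel`, then `P s w = 0` for every `w ∈ ⟨S⟩`.
[folklore] (re-proved from `…BorelOrderTelescope`, where it is private) -/
private theorem pairing_eq_zero_of_mem_closure' {Sel : AddSubgroup V} {R : Type*} [AddCommGroup R]
    (P : Sel →+ Sel →+ R) {S : Set V} (hle : S ⊆ Sel) {s : V} (hs : s ∈ Sel)
    (h0 : ∀ (w : V) (hw : w ∈ S), P ⟨w, hle hw⟩ ⟨s, hs⟩ = 0) {w : V} (hw : w ∈ AddSubgroup.closure S)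
    (hwSel : w ∈ Sel) : P ⟨w, hwSel⟩ ⟨s, hs⟩ = 0 := by
  have hle' : AddSubgroup.closure S ≤ Sel := (AddSubgroup.closure_le _).mpr hle
  suffices h : ∀ (w : V) (hw : w ∈ AddSubgroup.closure S), P ⟨w, hle' hw⟩ ⟨s, hs⟩ = 0 from h w hw
  intro w hw
  induction hw using AddSubgroup.closure_induction with
  | mem w hw => exact h0 w hw
  | zero => rw [show (⟨0, hle' (zero_mem _)⟩ : Sel) = 0 from rfl, map_zero, AddMonoidHom.zero_apply]
  | add w w' hw hw' ih ih' =>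
    rw [show (⟨w + w', hle' (add_mem hw hw')⟩ : Sel) = ⟨w, hle' hw⟩ + ⟨w', hle' hw'⟩ from rfl, map_add,
      AddMonoidHom.add_apply, ih, ih', add_zero]
  | neg w hw ih =>
    rw [show (⟨-w, hle' (neg_mem hw)⟩ : Sel) = -⟨w, hle' hw⟩ from rfl, map_neg, AddMonoidHom.neg_apply, ih,
      neg_zero]

/-- `ℓ n` is a square-free product of Kolyvagin primes for such an `n` and a Kolyvagin prime `ℓ ∤ n`. [folklore] -/
private theorem kolSupp_mul_of_not_dvd'' {Kol : ℕ → Prop} (hKol : ∀ ℓ, Kol ℓ → ℓ.Prime) {ℓ n : ℕ}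
    (hℓ : Kol ℓ) (hn : KolSupp Kol n) (hℓn : ¬ ℓ ∣ n) : KolSupp Kol (ℓ * n) := by
  have hℓp := hKol ℓ hℓ
  refine ⟨?_, fun q hq ↦ ?_⟩
  · rw [Nat.squarefree_mul_iff]
    exact ⟨(Nat.Prime.coprime_iff_not_dvd hℓp).mpr hℓn, hℓp.squarefree, hn.1⟩
  · rw [Nat.primeFactors_mul hℓp.ne_zero hn.1.ne_zero, Finset.mem_union, hℓp.primeFactors,
      Finset.mem_singleton] at hq
    rcases hq with rfl | hq
    · exact hℓ
    · exact hn.2 q hq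

/-- `ℓ n` has one more prime factor than `n` (`ℓ ∤ n`). [folklore] -/
private theorem card_primeFactors_mul_of_not_dvd'' {ℓ n : ℕ} (hℓ : ℓ.Prime) (hn : n ≠ 0) (hℓn : ¬ ℓ ∣ n) :
    (ℓ * n).primeFactors.card = n.primeFactors.card + 1 := by
  rw [Nat.primeFactors_mul hℓ.ne_zero hn, hℓ.primeFactors, ← Finset.insert_eq,
    Finset.card_insert_of_notMem fun h ↦ hℓn (Nat.dvd_of_mem_primeFactors h)]

/-- The signs `ε(−1)^i` are `±1`. [folklore] -/
private theorem sign_pow_cases'' {ε : ℤ} (hε : ε = 1 ∨ ε = -1) (i : ℕ) :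
    ε * (-1) ^ i = 1 ∨ ε * (-1) ^ i = -1 := by
  rcases hε with h | h <;> rcases neg_one_pow_eq_or ℤ i with h' | h' <;> simp [h, h']

/-- The running budget grows by `D (k+1)` at step `k+1`. [folklore] -/
private theorem sum_Ioc_succ_eq (D : ℕ → ℕ) (k : ℕ) :
    ∑ j ∈ Finset.Ioc 0 (k + 1), D j = (∑ j ∈ Finset.Ioc 0 k, D j) + D (k + 1) :=
  Finset.sum_Ioc_succ_top (Nat.zero_le k) D

/-- The running budget is monotone in the step. [folklore] -/
private theorem sum_Ioc_le_sum_Ioc (D : ℕ → ℕ) {k K : ℕ} (hk : k ≤ K) :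
    ∑ j ∈ Finset.Ioc 0 k, D j ≤ ∑ j ∈ Finset.Ioc 0 K, D j :=
  Finset.sum_le_sum_of_subset (Finset.Ioc_subset_Ioc_right hk)

end Prelim

/-! ## §1 The Cassels–Tate telescope with a step-dependent defect budget -/

section Telescope

variable {V : Type*} [AddCommGroup V] {Pl : Type*}
variable {p M M₀ M₁ : ℕ} {ε : ℤ} {τ : V →+ V} {Sel : AddSubgroup V} {Loc : Pl → AddSubgroup V}
  {Kol : ℕ → Prop} {pl : ℕ → Pl} {A : ℕ → AddSubgroup V} {x : V} {c : ℕ → V}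
  {expo : V → ℕ} {D : ℕ → ℕ} {K : ℕ} {s : ℕ → V}

/-- **McCallum 1991, proof of Thm. 5.4 — the chain `n_k = ℓ₁⋯ℓ_k`, with the invariant (I) carrying a
STEP-DEPENDENT defect budget `D : ℕ → ℕ`.** Data as in `…BorelOrderTelescope.exists_chain_of_casselsTate_defect`
(`V` killed by `p^M`, exact exponents `expo`, Kolyvagin primes `Kol`, `Sel` cut out by `Loc`, strict conditions
`A ℓ`, `x` of order `p^M`, Kolyvagin classes `c` with `c 1 = p^{M₀} x`, their signs and Prop. 4.4, the
Cassels–Tate value `hCTV` at the auxiliary level `M₁`), except that the kernel-form Čebotarev supplier `hCebD`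
receives the STEP INDEX `j ∈ (0, K]` — the lift `s_j` (sign `ν`), a class `g₂` of sign `−ν`, a finite set `T` of
eigenclasses, a bound `b` — and returns a Kolyvagin prime `ℓ > b` killing `T` together with ITS OWN split
`d₁ + d₂ ≤ D j` of the step's budget: `p^i s_j ∈ A ℓ ⟹ p^{i+d₁} s_j ∈ ⟨T⟩`, `p^i g₂ ∈ A ℓ ⟹ p^{i+d₂} g₂ ∈ ⟨T⟩`
(the per-step CHOICE of the Frobenius type, §4). For alternating eigen-lifts `s₁,…,s_K ∈ Sel`, pairwise
`P`-isotropic, independent with `x`, with `expo sᵢ + M₁ ≤ M` and `M₀ + Σ_{j≤K} D j ≤ M₁`: for every `k ≤ K` there is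
`n = n_k` (square-free product of `k` Kolyvagin primes) with the later lifts in `A q` at every `q ∣ n` and
**(I_D)** `p^i c(n) ∈ ⟨s_j : k < j ≤ K⟩ ⟹ (M − M₀) + Σ_{j≤k} expo s_j ≤ i + Σ_{j≤k} D j`.
[cite: McCallumLMS1991, Thm. 5.4 (proof, (16)–(23)), Prop. 4.7, Lemma 5.3, Prop. 3.1] -/
theorem exists_chain_of_casselsTate_stepDefect (hp : p.Prime) (hε : ε = 1 ∨ ε = -1)
    (htor : ∀ v : V, ((p : ℤ) ^ M) • v = 0)
    (hexpo : ∀ (v : V) (a : ℕ), ((p : ℤ) ^ a) • v = 0 ↔ expo v ≤ a)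
    (hKol : ∀ ℓ, Kol ℓ → ℓ.Prime) (hSel : ∀ s, s ∈ Sel ↔ ∀ v, s ∈ Loc v)
    (hxord : ((p : ℤ) ^ (M - 1)) • x ≠ 0) (hc1 : c 1 = ((p : ℤ) ^ M₀) • x)
    (hτc : ∀ n, KolSupp Kol n → τ (c n) = (ε * (-1) ^ n.primeFactors.card) • c n)
    (hc44 : ∀ ℓ m, Kol ℓ → KolSupp Kol (ℓ * m) → ∀ a : ℕ,
      (((p : ℤ) ^ a) • c (ℓ * m) ∈ Loc (pl ℓ)) ↔ ((p : ℤ) ^ a) • c m ∈ A ℓ)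
    {R : Type*} [AddCommGroup R] (P : Sel →+ Sel →+ R)
    (hCTV : ∀ ℓ m : ℕ, Kol ℓ → KolSupp Kol (ℓ * m) → ¬ ℓ ∣ m →
      ∀ (j N a b : ℕ) (t : V) (ht : t ∈ Sel) (hz : ((p : ℤ) ^ j) • c (ℓ * m) ∈ Sel),
      ((p : ℤ) ^ N) • t = 0 → τ t = (ε * (-1) ^ (ℓ * m).primeFactors.card) • t →
      (∀ q ∈ m.primeFactors, t ∈ A q) → M - M₁ ≤ j → N + M₁ ≤ M → N ≤ j → a + b + 1 = N →
      ((p : ℤ) ^ (a + (j - N))) • c m ∉ A ℓ → ((p : ℤ) ^ b) • t ∉ A ℓ →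
      P ⟨_, hz⟩ ⟨t, ht⟩ ≠ 0)
    (hsel : ∀ i, s i ∈ Sel)
    (hτs : ∀ i ∈ Finset.Ioc 0 K, τ (s i) = (ε * (-1) ^ i) • s i)
    (hiso : ∀ i ∈ Finset.Ioc 0 K, ∀ i' ∈ Finset.Ioc 0 K, P ⟨s i, hsel i⟩ ⟨s i', hsel i'⟩ = 0)
    (hind : ∀ (b : ℤ) (a : ℕ → ℤ), b • x + ∑ i ∈ Finset.Ioc 0 K, a i • s i = 0 →
      b • x = 0 ∧ ∀ i ∈ Finset.Ioc 0 K, a i • s i = 0)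
    (hCebD : ∀ j ∈ Finset.Ioc 0 K, ∀ (T : Finset V) (g₂ : V) (ν : ℤ), (ν = 1 ∨ ν = -1) →
      τ (s j) = ν • s j → τ g₂ = (-ν) • g₂ → (∀ t ∈ T, ∃ e : ℤ, (e = 1 ∨ e = -1) ∧ τ t = e • t) →
      ∀ b : ℕ, ∃ ℓ, b < ℓ ∧ Kol ℓ ∧ (∀ t ∈ T, t ∈ A ℓ) ∧ ∃ d₁ d₂ : ℕ, d₁ + d₂ ≤ D j ∧
        (∀ i : ℕ, ((p : ℤ) ^ i) • s j ∈ A ℓ →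
          ((p : ℤ) ^ (i + d₁)) • s j ∈ AddSubgroup.closure (T : Set V)) ∧
        (∀ i : ℕ, ((p : ℤ) ^ i) • g₂ ∈ A ℓ →
          ((p : ℤ) ^ (i + d₂)) • g₂ ∈ AddSubgroup.closure (T : Set V)))
    (hM₁ : M₀ + ∑ j ∈ Finset.Ioc 0 K, D j ≤ M₁) (hroom : ∀ i ∈ Finset.Ioc 0 K, expo (s i) + M₁ ≤ M)
    (k : ℕ) (hk : k ≤ K) :
    ∃ n, KolSupp Kol n ∧ n.primeFactors.card = k ∧
      (∀ q ∈ n.primeFactors, ∀ i ∈ Finset.Ioc k K, s i ∈ A q) ∧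
      ∀ i : ℕ, ((p : ℤ) ^ i) • c n ∈
          AddSubgroup.closure (((Finset.Ioc k K).image s : Finset V) : Set V) →
        (M - M₀) + ∑ j ∈ Finset.Ioc 0 k, expo (s j) ≤ i + ∑ j ∈ Finset.Ioc 0 k, D j := by
  -- the pools `⟨s_j : k < j ≤ K⟩` lie in `Sel`
  have hpool : ∀ k, (((Finset.Ioc k K).image s : Finset V) : Set V) ⊆ Sel := by
    intro k v hv
    rw [Finset.coe_image, Set.mem_image] at hv
    obtain ⟨i, -, rfl⟩ := hv
    exact hsel i
  induction k with
  | zero =>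
    refine ⟨1, kolSupp_one _, by simp, by simp, fun i hi ↦ ?_⟩
    rw [hc1, smul_smul, ← pow_add] at hi
    have h0 := zsmul_x_eq_zero_of_mem_closure_Ioc' hind hi
    rw [zsmul_eq_zero_iff_prime_pow_dvd hp (htor x) hxord, ← Nat.cast_pow, ← Nat.cast_pow,
      Int.natCast_dvd_natCast, Nat.pow_dvd_pow_iff_le_right hp.one_lt] at h0
    simp only [Finset.Ioc_self, Finset.sum_empty, add_zero]
    omega
  | succ k ih =>
    obtain ⟨n, hn, hcard, hA, hI⟩ := ih (by omega)
    have hn0 : n ≠ 0 := hn.1.ne_zero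
    have hk1 : k + 1 ∈ Finset.Ioc 0 K := by simp only [Finset.mem_Ioc]; omega
    have hk1' : k + 1 ∈ Finset.Ioc k K := by simp only [Finset.mem_Ioc]; omega
    -- the running budget
    have hSD : ∑ j ∈ Finset.Ioc 0 (k + 1), D j = (∑ j ∈ Finset.Ioc 0 k, D j) + D (k + 1) :=
      sum_Ioc_succ_eq D k
    have hSDK : ∑ j ∈ Finset.Ioc 0 (k + 1), D j ≤ ∑ j ∈ Finset.Ioc 0 K, D j :=
      sum_Ioc_le_sum_Ioc D (by omega)
    -- signs: `s_{k+1} ∈ V^{ν}`, `c(n_k) ∈ V^{-ν}`, `ν = ε (-1)^{k+1}`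
    set ν : ℤ := ε * (-1) ^ (k + 1) with hν
    have hν1 : ν = 1 ∨ ν = -1 := sign_pow_cases'' hε (k + 1)
    have hτs' : τ (s (k + 1)) = ν • s (k + 1) := hτs (k + 1) hk1
    have hτcn : τ (c n) = (-ν) • c n := by
      rw [hτc n hn, hcard, hν, pow_succ]
      congr 1
      ring
    set T : Finset V := (Finset.Ioc (k + 1) K).image s with hT
    have hTτ : ∀ t ∈ T, ∃ e : ℤ, (e = 1 ∨ e = -1) ∧ τ t = e • t := by
      intro t ht
      rw [hT, Finset.mem_image] at ht
      obtain ⟨i, hi, rfl⟩ := ht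
      refine ⟨_, sign_pow_cases'' hε i, hτs i ?_⟩
      simp only [Finset.mem_Ioc] at hi ⊢
      omega
    -- the sub-pool `⟨T⟩ ≤ ⟨s_j : k < j⟩`
    have hTsub : (T : Set V) ⊆ (((Finset.Ioc k K).image s : Finset V) : Set V) := by
      rw [hT, Finset.coe_image, Finset.coe_image]
      apply Set.image_mono
      intro i hi
      simp only [Finset.coe_Ioc, Set.mem_Ioc] at hi ⊢
      omega
    -- ### the Kolyvagin prime `ℓ = ℓ_{k+1}` of the step's chosen type (McCallum (21)–(23), defective form)
    obtain ⟨ℓ, hℓn, hℓ, hTA, d₁, d₂, hd, hF1, hF2⟩ :=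
      hCebD (k + 1) hk1 T (c n) ν hν1 hτs' hτcn hTτ n
    have hℓp := hKol ℓ hℓ
    have hndvd : ¬ ℓ ∣ n := fun h ↦ by
      have := Nat.le_of_dvd (Nat.pos_of_ne_zero hn0) h
      omega
    have hsupp : KolSupp Kol (ℓ * n) := kolSupp_mul_of_not_dvd'' hKol hℓ hn hndvd
    have hcard' : (ℓ * n).primeFactors.card = k + 1 := by
      rw [card_primeFactors_mul_of_not_dvd'' hℓp hn0 hndvd, hcard]
    -- Fact B (defective): `p^{i'} c(n)_λ = 0 ⟹ (M - M₀) + ∑_{j ≤ k} N_j ≤ i' + d₂ + Σ_{j≤k} D j`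
    have hB : ∀ i' : ℕ, ((p : ℤ) ^ i') • c n ∈ A ℓ →
        (M - M₀) + ∑ j ∈ Finset.Ioc 0 k, expo (s j) ≤ i' + d₂ + ∑ j ∈ Finset.Ioc 0 k, D j :=
      fun i' hi' ↦ hI _ (AddSubgroup.closure_mono hTsub (hF2 i' hi'))
    refine ⟨ℓ * n, hsupp, hcard', fun q hq i hi ↦ ?_, fun i hi ↦ ?_⟩
    · -- (19)/(23): the later lifts vanish at the primes of `ℓ n`
      rw [Nat.primeFactors_mul hℓp.ne_zero hn0, Finset.mem_union, hℓp.primeFactors,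
        Finset.mem_singleton] at hq
      rcases hq with rfl | hq
      · apply hTA
        rw [hT, Finset.mem_image]
        exact ⟨i, by simpa using hi, rfl⟩
      · refine hA q hq i ?_
        simp only [Finset.mem_Ioc] at hi ⊢
        omega
    · -- ### the invariant (I_D) at `k + 1`
      rw [Finset.sum_Ioc_succ_top (Nat.zero_le k), ← add_assoc, hSD]
      have hSel' : ((p : ℤ) ^ i) • c (ℓ * n) ∈ Sel :=
        (AddSubgroup.closure_le _).mpr ((hT ▸ hpool (k + 1))) hi
      have hAℓ : ((p : ℤ) ^ i) • c n ∈ A ℓ :=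
        (hc44 ℓ n hℓ hsupp i).mp ((hSel _).mp hSel' (pl ℓ))
      have hB0 := hB i hAℓ
      set N : ℕ := expo (s (k + 1)) with hNdef
      by_cases hN : N ≤ d₁
      · -- the lift is (possibly) invisible: the whole step is paid from the budget
        omega
      push Not at hN
      by_contra hlt
      push Not at hlt
      have hroom' := hroom (k + 1) hk1
      have hNi : N ≤ i := by omega
      have hMi : M - M₁ ≤ i := by omega
      -- (21), defective: `p^{d₁ + (i - N)} c(n)_λ ≠ 0`
      have hnot : ((p : ℤ) ^ (d₁ + (i - N))) • c n ∉ A ℓ := by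
        intro h
        have h1 := hB _ h
        omega
      -- (22), defective: `s_{k+1}` has order at least `ord / p^{d₁}` at `λ`
      have hsfull : ((p : ℤ) ^ (N - 1 - d₁)) • s (k + 1) ∉ A ℓ := by
        intro h
        have hT' := hF1 _ h
        rw [show N - 1 - d₁ + d₁ = N - 1 by omega] at hT'
        exact pow_zsmul_ne_zero_of_lt_expo hexpo (show N - 1 < expo (s (k + 1)) by omega)
          (zsmul_eq_zero_of_mem_closure_Ioc' hind hk1 (hT ▸ hT'))
      have hτsk : τ (s (k + 1)) = (ε * (-1) ^ (ℓ * n).primeFactors.card) • s (k + 1) := by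
        rw [hcard']
        exact hτs'
      have hAq : ∀ q ∈ n.primeFactors, s (k + 1) ∈ A q := fun q hq ↦ hA q hq (k + 1) hk1'
      have hne := hCTV ℓ n hℓ hsupp hndvd i N d₁ (N - 1 - d₁)
        (s (k + 1)) (hsel _) hSel' (pow_expo_zsmul_eq_zero hexpo _) hτsk hAq hMi hroom' hNi
        (by omega) hnot hsfull
      -- isotropy of `⟨T⟩ ∋ p^i c(n_{k+1})` with `s_{k+1}`
      refine hne (pairing_eq_zero_of_mem_closure' P (hT ▸ hpool (k + 1)) (hsel (k + 1))
        (fun w hw ↦ ?_) hi hSel')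
      rw [hT, Finset.coe_image, Set.mem_image] at hw
      obtain ⟨i', hi', rfl⟩ := hw
      refine hiso i' ?_ (k + 1) hk1
      simp only [Finset.coe_Ioc, Set.mem_Ioc, Finset.mem_Ioc] at hi' ⊢
      omega

/-! ## §2 The ledger with a step-dependent budget: `Σ Nⱼ ≤ M₀ + Σ D j` -/

/-- **Kolyvagin's order telescope with a step-dependent defect budget: `Σ_{j≤K} expo s_j ≤ M₀ + Σ_{j≤K} D j`.**
(McCallum 1991 §1 Theorem with Thm. 5.4 "≤" and Cor. 5.6, telescope form; the tree's
`HypothesesM.sum_expo_le_M₀_of_casselsTate` is `D ≡ 0`, file II's `sum_expo_le_M₀_add_of_casselsTate_defect` is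
`D ≡ Δ1 + Δ(−1)`, §3.) For the lifts `s₁,…,s_K` of the generators of a maximal isotropic `⊕ Dᵢ` of
`Ш_{p^∞} = Sel/ℤx` this reads `#Ш_{p^∞} ≤ p^{2M₀ + 2Σ D j}`.
[cite: McCallumLMS1991, §1 Theorem; Thm. 5.4 (proof), Cor. 5.6; Prop. 3.1, Prop. 4.7, Lemma 5.3] -/
theorem sum_expo_le_M₀_add_sum_of_casselsTate_stepDefect (hp : p.Prime) (hε : ε = 1 ∨ ε = -1)
    (htor : ∀ v : V, ((p : ℤ) ^ M) • v = 0)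
    (hexpo : ∀ (v : V) (a : ℕ), ((p : ℤ) ^ a) • v = 0 ↔ expo v ≤ a)
    (hKol : ∀ ℓ, Kol ℓ → ℓ.Prime) (hSel : ∀ s, s ∈ Sel ↔ ∀ v, s ∈ Loc v)
    (hxord : ((p : ℤ) ^ (M - 1)) • x ≠ 0) (hc1 : c 1 = ((p : ℤ) ^ M₀) • x)
    (hτc : ∀ n, KolSupp Kol n → τ (c n) = (ε * (-1) ^ n.primeFactors.card) • c n)
    (hc44 : ∀ ℓ m, Kol ℓ → KolSupp Kol (ℓ * m) → ∀ a : ℕ,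
      (((p : ℤ) ^ a) • c (ℓ * m) ∈ Loc (pl ℓ)) ↔ ((p : ℤ) ^ a) • c m ∈ A ℓ)
    {R : Type*} [AddCommGroup R] (P : Sel →+ Sel →+ R)
    (hCTV : ∀ ℓ m : ℕ, Kol ℓ → KolSupp Kol (ℓ * m) → ¬ ℓ ∣ m →
      ∀ (j N a b : ℕ) (t : V) (ht : t ∈ Sel) (hz : ((p : ℤ) ^ j) • c (ℓ * m) ∈ Sel),
      ((p : ℤ) ^ N) • t = 0 → τ t = (ε * (-1) ^ (ℓ * m).primeFactors.card) • t →
      (∀ q ∈ m.primeFactors, t ∈ A q) → M - M₁ ≤ j → N + M₁ ≤ M → N ≤ j → a + b + 1 = N →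
      ((p : ℤ) ^ (a + (j - N))) • c m ∉ A ℓ → ((p : ℤ) ^ b) • t ∉ A ℓ →
      P ⟨_, hz⟩ ⟨t, ht⟩ ≠ 0)
    (hsel : ∀ i, s i ∈ Sel)
    (hτs : ∀ i ∈ Finset.Ioc 0 K, τ (s i) = (ε * (-1) ^ i) • s i)
    (hiso : ∀ i ∈ Finset.Ioc 0 K, ∀ i' ∈ Finset.Ioc 0 K, P ⟨s i, hsel i⟩ ⟨s i', hsel i'⟩ = 0)
    (hind : ∀ (b : ℤ) (a : ℕ → ℤ), b • x + ∑ i ∈ Finset.Ioc 0 K, a i • s i = 0 →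
      b • x = 0 ∧ ∀ i ∈ Finset.Ioc 0 K, a i • s i = 0)
    (hCebD : ∀ j ∈ Finset.Ioc 0 K, ∀ (T : Finset V) (g₂ : V) (ν : ℤ), (ν = 1 ∨ ν = -1) →
      τ (s j) = ν • s j → τ g₂ = (-ν) • g₂ → (∀ t ∈ T, ∃ e : ℤ, (e = 1 ∨ e = -1) ∧ τ t = e • t) →
      ∀ b : ℕ, ∃ ℓ, b < ℓ ∧ Kol ℓ ∧ (∀ t ∈ T, t ∈ A ℓ) ∧ ∃ d₁ d₂ : ℕ, d₁ + d₂ ≤ D j ∧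
        (∀ i : ℕ, ((p : ℤ) ^ i) • s j ∈ A ℓ →
          ((p : ℤ) ^ (i + d₁)) • s j ∈ AddSubgroup.closure (T : Set V)) ∧
        (∀ i : ℕ, ((p : ℤ) ^ i) • g₂ ∈ A ℓ →
          ((p : ℤ) ^ (i + d₂)) • g₂ ∈ AddSubgroup.closure (T : Set V)))
    (hM₁ : M₀ + ∑ j ∈ Finset.Ioc 0 K, D j ≤ M₁) (hroom : ∀ i ∈ Finset.Ioc 0 K, expo (s i) + M₁ ≤ M) :
    ∑ j ∈ Finset.Ioc 0 K, expo (s j) ≤ M₀ + ∑ j ∈ Finset.Ioc 0 K, D j := by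
  obtain ⟨n, -, -, -, hI⟩ := exists_chain_of_casselsTate_stepDefect hp hε htor hexpo hKol hSel hxord hc1 hτc
    hc44 P hCTV hsel hτs hiso hind hCebD hM₁ hroom K le_rfl
  have := hI M (by rw [htor]; exact zero_mem _)
  omega

end Telescope

end Summit.BirchSwinnertonDyer.BirchSwinnertonDyer.Theorems.PrintCFram.BorelDescent

end
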